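import Literature.Analysis.FunctionSpaces.LittlewoodPaleyMultiplierProofs
import Literature.Analysis.FunctionSpaces.LittlewoodPaleyKernel
import Literature.Analysis.FluidPDE.TaoAveragedSobolev

/-!
# Stub `besovDuhamelBound` for `PerpetualPump.Thesis`, part II: order-`0` symbols on the
# dyadic blocks, with constants linear in Tao's symbol seminorms

Support file (part 2 of the stub `besovDuhamelBound` of line `SketchIdeator2`, crux
stmt-NavierStokesRegularity-1832). The averaged Euler operator of an averaging datum
(T. Tao, J. Amer. Math. Soc. 29 (2016), (1.12)–(1.13)) conjugates the Euler bilinear operator by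
random order-`0` Fourier multipliers `m_{i,θ}(D)`, whose only control is through the seminorms
`‖m‖_k = sup_{ξ ≠ 0} |ξ|ᵏ ‖∇ᵏ m(ξ)‖` (Tao (1.10), tree `symbolSeminorm`) and their mixed moments.
To average the block estimates of the Littlewood–Paley theory over `θ` every constant must be
**explicitly linear in `∑_{k ≤ n} ‖m‖_k`** for a fixed order `n`; the accepted
`LittlewoodPaleyMultiplierProofs.lean` (BCD Lemma 2.2) hides this dependence in an existential
constant. This file re-derives the relevant bounds with the dependence displayed:

* `FA.exists_norm_iteratedFDeriv_rescaled_mul_bernstein_le`: derivatives of `m(c ·) ψ` on the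
  annulus `1/4 ≤ |ξ| ≤ 4` are `≤ K₀ ∑_{i ≤ n} C_i` for **every dilation factor `c > 0`** when
  `‖Dⁱ m(ξ)‖ ≤ C_i |ξ|^{-i}` (BCD, proof of Lemma 2.2, with the scale-invariance made uniform);
* `FA.norm_iteratedFDeriv_le_of_isRealSymbol`: Tao's real order-`0` symbols satisfy these
  hypotheses with `C_i = ‖m‖_i`;
* `FA.exists_eLpNormDistrib_truncSymbol_lpBlock_le_sum`: **BCD Lemma 2.2 on `Ḃ⁰_{∞,·}` blocks with
  constant `C ∑_{i ≤ n} ‖m‖_i`**: `‖(m ψ_j)(D) Δ̇_j u‖_{L^∞} ≤ C (∑_{i≤n} ‖m‖_i) ‖Δ̇_j u‖_{L^∞}`;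
* `FA.exists_norm_iteratedFDeriv_dyadicSymbol_comp_le`: the dyadic bump composed with a linear map
  `L` has derivatives `≤ Q max(1,‖L‖)ⁿ` (rotated / non-dyadically dilated blocks are admissible
  multipliers with universal constants);
* `FA.norm_iteratedFDeriv_mul_le_of_le`: pointwise Leibniz bound `‖Dᴺ(fg)(x)‖ ≤ 2ᴺ B_f B_g`;
* `FA.exists_eLpNorm_fourierInv_smulLeftCLM_bernstein_le`: `‖𝓕⁻¹(G ψ)‖_{L¹} ≤ C₀ B` whenever the
  derivatives of order `≤ n` of the temperate multiplier `G` are `≤ B` on the annulus (the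
  `L¹`-kernel lemma behind every `L^∞` block estimate; BCD, proof of Lemma 2.2).

## References

* H. Bahouri, J.-Y. Chemin, R. Danchin, *Fourier Analysis and Nonlinear PDE* (2011), Lemma 2.2.
* T. Tao, J. Amer. Math. Soc. 29 (2016), 601–674, (1.10), (1.12)–(1.13).
-/

noncomputable section

open MeasureTheory TemperedDistribution SchwartzMap Filter Topology Function FourierTransform
open scoped SchwartzMap ENNReal NNReal Real ContDiff

set_option linter.dupNamespace false

namespace Summit.NavierStokesRegularity.NavierStokesRegularity.Theorems.PerpetualPumpThesis.FA

open Literature.Analysis.FunctionSpaces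

section General

variable {E : Type*} [NormedAddCommGroup E] [InnerProductSpace ℝ E] [FiniteDimensional ℝ E]

/-! ### Leibniz at a point -/

omit [InnerProductSpace ℝ E] [FiniteDimensional ℝ E] in
/-- **Pointwise Leibniz bound** for complex functions (any real normed space `E`, viewed through
`NormedSpace ℝ E`): if the derivatives of `f`, `g` of order `≤ n` at `x` are bounded by `Bf`, `Bg`,
then `‖Dᴺ(fg)(x)‖ ≤ 2ᴺ Bf Bg` for `N ≤ n`. -/
theorem norm_iteratedFDeriv_mul_le_of_le [NormedSpace ℝ E] {f g : E → ℂ} (hf : ContDiff ℝ ∞ f)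
    (hg : ContDiff ℝ ∞ g) (x : E) {n : ℕ} {Bf Bg : ℝ} (hBf : ∀ i ≤ n, ‖iteratedFDeriv ℝ i f x‖ ≤ Bf)
    (hBg : ∀ i ≤ n, ‖iteratedFDeriv ℝ i g x‖ ≤ Bg) {N : ℕ} (hN : N ≤ n) :
    ‖iteratedFDeriv ℝ N (fun y => f y * g y) x‖ ≤ 2 ^ N * Bf * Bg := by
  have hBf0 : 0 ≤ Bf := (norm_nonneg _).trans (hBf 0 (Nat.zero_le _))
  have h := norm_iteratedFDeriv_mul_le hf hg x (n := N) (mod_cast le_top)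
  refine h.trans ?_
  calc ∑ i ∈ Finset.range (N + 1),
        (N.choose i : ℝ) * ‖iteratedFDeriv ℝ i f x‖ * ‖iteratedFDeriv ℝ (N - i) g x‖
      ≤ ∑ i ∈ Finset.range (N + 1), (N.choose i : ℝ) * Bf * Bg := by
        refine Finset.sum_le_sum fun i hi => ?_
        have hiN : i ≤ N := Nat.lt_succ_iff.mp (Finset.mem_range.mp hi)
        have h1 := hBf i (hiN.trans hN)
        have h2 := hBg (N - i) ((Nat.sub_le N i).trans hN)
        calc (N.choose i : ℝ) * ‖iteratedFDeriv ℝ i f x‖ * ‖iteratedFDeriv ℝ (N - i) g x‖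
            ≤ (N.choose i : ℝ) * Bf * ‖iteratedFDeriv ℝ (N - i) g x‖ := by
              gcongr
          _ ≤ (N.choose i : ℝ) * Bf * Bg := by
              gcongr
    _ = 2 ^ N * Bf * Bg := by
        rw [← Finset.sum_mul, ← Finset.sum_mul, ← Nat.cast_sum, Nat.sum_range_choose]
        push_cast
        ring

/-! ### Rescaled truncated order-`0` symbols, uniformly in the dilation factor -/

/-- **Derivatives of `ξ ↦ m(cξ) ψ(ξ)` on the annulus, uniformly in `c > 0` and linearly in the
symbol bounds.** For every order `n` there is `K₀` such that for every symbol `m ∈ C^∞(E ∖ {0})`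
with `‖Dⁱ m(ξ)‖ ≤ C_i ‖ξ‖^{-i}` (`i ≤ n`, `ξ ≠ 0`), every `c > 0`, `N ≤ n` and `x` with
`1/4 ≤ ‖x‖ ≤ 4`: `‖Dᴺ[m(c ·) ψ](x)‖ ≤ K₀ ∑_{i ≤ n} |C_i|` (`ψ` the reproducing symbol of `Δ̇₀`).
The point is the scale invariance `‖Dⁱ[m(c ·)](x)‖ ≤ cⁱ C_i (c‖x‖)^{-i} = C_i ‖x‖^{-i}`. -/
theorem exists_norm_iteratedFDeriv_rescaled_mul_bernstein_le (n : ℕ) :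
    ∃ K₀ : ℝ, 0 ≤ K₀ ∧ ∀ (σ : E → ℂ), ContDiffOn ℝ ∞ σ {0}ᶜ → ∀ (Cσ : ℕ → ℝ),
      (∀ N ≤ n, ∀ ξ : E, ξ ≠ 0 → ‖iteratedFDeriv ℝ N σ ξ‖ ≤ Cσ N * ‖ξ‖ ^ (-(N : ℝ))) →
      ∀ c : ℝ, 0 < c → ∀ N ≤ n, ∀ x ∈ blockAnnulus E,
        ‖iteratedFDeriv ℝ N (fun ξ : E => σ (c • ξ) * bernsteinSymbol ξ) x‖ ≤
          K₀ * ∑ i ∈ Finset.range (n + 1), |Cσ i| := by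
  -- adapted from `exists_norm_iteratedFDeriv_truncSymbol_rescaled_le` (LittlewoodPaleyMultiplierProofs)
  set S : Set E := {0}ᶜ with hSdef
  have hS : IsOpen S := isOpen_compl_singleton
  have hSu : UniqueDiffOn ℝ S := hS.uniqueDiffOn
  set A : ℝ := (4 : ℝ) ^ n with hA
  have hA0 : 0 ≤ A := by positivity
  set P : ℝ := (Finset.Iic ((0 : ℕ), n)).sup (schwartzSeminormFamily ℂ E ℂ) (bernsteinSchwartz E)
    with hP
  have hP0 : 0 ≤ P := apply_nonneg _ _
  refine ⟨2 ^ n * A * P, by positivity, fun σ hσ Cσ hCσ c hc N hN x hx => ?_⟩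
  set Csum : ℝ := ∑ i ∈ Finset.range (n + 1), |Cσ i| with hCsum
  have hCsum0 : 0 ≤ Csum := Finset.sum_nonneg fun i _ => abs_nonneg _
  have hx0 : x ≠ 0 := fun h => by
    have := hx.1; rw [h, norm_zero] at this; norm_num at this
  have hxS : x ∈ S := hx0
  have hxpos : 0 < ‖x‖ := norm_pos_iff.2 hx0
  set g : E →L[ℝ] E := c • ContinuousLinearMap.id ℝ E with hg
  have hgx : ∀ y : E, g y = c • y := fun y => rfl
  have hpre : ⇑g ⁻¹' S = S := by
    ext y
    simp only [Set.mem_preimage, hSdef, Set.mem_compl_iff, Set.mem_singleton_iff, hgx,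
      smul_eq_zero, hc.ne', false_or]
  have hgnorm : ‖g‖ ≤ c := by
    rw [hg, norm_smul, Real.norm_of_nonneg hc.le]
    exact (mul_le_mul_of_nonneg_left ContinuousLinearMap.norm_id_le hc.le).trans (mul_one c).le
  have hfun : (fun ξ : E => σ (c • ξ) * bernsteinSymbol ξ) = fun ξ => (σ ∘ ⇑g) ξ * bernsteinSymbol ξ := by
    funext ξ
    rfl
  have hσg : ContDiffOn ℝ ∞ (σ ∘ ⇑g) S := by
    rw [← hpre]
    exact hσ.comp g.contDiff.contDiffOn (fun y hy => hy)
  have hψS : ContDiffOn ℝ ∞ (bernsteinSymbol : E → ℂ) S := contDiff_bernsteinSymbol.contDiffOn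
  rw [hfun, ← iteratedFDerivWithin_of_isOpen N hS hxS]
  have hleib := norm_iteratedFDerivWithin_mul_le hσg hψS hSu hxS (n := N) (mod_cast le_top)
  refine hleib.trans ?_
  have hterm : ∀ i ∈ Finset.range (N + 1),
      (N.choose i : ℝ) * ‖iteratedFDerivWithin ℝ i (σ ∘ ⇑g) S x‖ *
        ‖iteratedFDerivWithin ℝ (N - i) (bernsteinSymbol : E → ℂ) S x‖ ≤
      (N.choose i : ℝ) * (Csum * A * P) := by
    intro i hi
    have hiN : i ≤ N := Nat.lt_succ_iff.mp (Finset.mem_range.mp hi)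
    have hin : i ≤ n := hiN.trans hN
    -- the `σ` factor: scale invariance
    have h1 : ‖iteratedFDerivWithin ℝ i (σ ∘ ⇑g) S x‖ ≤ |Cσ i| * A := by
      have hcomp := ContinuousLinearMap.iteratedFDerivWithin_comp_right g hσ hSu (by rwa [hpre])
        (x := x) (by rw [← Set.mem_preimage, hpre]; exact hxS) (i := i) (mod_cast le_top)
      rw [hpre] at hcomp
      rw [hcomp]
      refine (ContinuousMultilinearMap.norm_compContinuousLinearMap_le _ _).trans ?_
      rw [Finset.prod_const, Finset.card_univ, Fintype.card_fin,
        iteratedFDerivWithin_of_isOpen i hS (show g x ∈ S by rw [← Set.mem_preimage, hpre]; exact hxS)]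
      have hgx0 : g x ≠ 0 := by rw [hgx]; exact smul_ne_zero hc.ne' hx0
      have hb := hCσ i hin (g x) hgx0
      rw [hgx, norm_smul, Real.norm_of_nonneg hc.le] at hb
      have hxmi : ‖x‖ ^ (-(i : ℝ)) ≤ A := by
        refine (norm_rpow_le_of_mem_blockAnnulus hx _).trans ?_
        rw [hA, abs_neg, Nat.abs_cast, Real.rpow_natCast]
        exact pow_le_pow_right₀ (by norm_num) hin
      have hci : (c * ‖x‖) ^ (-(i : ℝ)) * c ^ i = ‖x‖ ^ (-(i : ℝ)) := by
        rw [Real.mul_rpow hc.le (norm_nonneg _), ← Real.rpow_natCast c i,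
          mul_comm (c ^ (-(i : ℝ))), mul_assoc, ← Real.rpow_add hc, neg_add_cancel,
          Real.rpow_zero, mul_one]
      have hnn : 0 ≤ (c * ‖x‖) ^ (-(i : ℝ)) * c ^ i := by positivity
      calc ‖iteratedFDeriv ℝ i σ (g x)‖ * ‖g‖ ^ i
          ≤ (Cσ i * (c * ‖x‖) ^ (-(i : ℝ))) * c ^ i := by
            gcongr
            · exact le_trans (by positivity) hb
            · rw [hgx]; exact hb
          _ = Cσ i * ((c * ‖x‖) ^ (-(i : ℝ)) * c ^ i) := by ring
          _ ≤ |Cσ i| * ((c * ‖x‖) ^ (-(i : ℝ)) * c ^ i) :=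
            mul_le_mul_of_nonneg_right (le_abs_self _) hnn
          _ = |Cσ i| * ‖x‖ ^ (-(i : ℝ)) := by rw [hci]
          _ ≤ |Cσ i| * A := by gcongr
    -- the `ψ` factor
    have h2 : ‖iteratedFDerivWithin ℝ (N - i) (bernsteinSymbol : E → ℂ) S x‖ ≤ P := by
      rw [iteratedFDerivWithin_of_isOpen (N - i) hS hxS, ← coe_bernsteinSchwartz]
      have := le_seminorm ℂ 0 (N - i) (bernsteinSchwartz E) x
      rw [pow_zero, one_mul] at this
      refine this.trans (Seminorm.le_def.1 (Finset.le_sup (f := schwartzSeminormFamily ℂ E ℂ)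
        (Finset.mem_Iic.2 (Prod.mk_le_mk.2 ⟨le_rfl, (Nat.sub_le N i).trans hN⟩))) _)
    have h3 : |Cσ i| ≤ Csum := by
      rw [hCsum]
      exact Finset.single_le_sum (f := fun i => |Cσ i|) (fun _ _ => abs_nonneg _)
        (Finset.mem_range.2 (Nat.lt_succ_of_le hin))
    calc (N.choose i : ℝ) * ‖iteratedFDerivWithin ℝ i (σ ∘ ⇑g) S x‖ *
          ‖iteratedFDerivWithin ℝ (N - i) (bernsteinSymbol : E → ℂ) S x‖
        ≤ (N.choose i : ℝ) * (|Cσ i| * A) * P := by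
          gcongr
      _ ≤ (N.choose i : ℝ) * (Csum * A) * P := by gcongr
      _ = (N.choose i : ℝ) * (Csum * A * P) := by ring
  refine (Finset.sum_le_sum hterm).trans ?_
  rw [← Finset.sum_mul, ← Nat.cast_sum, Nat.sum_range_choose]
  push_cast
  have h2N : (2 : ℝ) ^ N ≤ 2 ^ n := pow_le_pow_right₀ one_le_two hN
  calc (2 : ℝ) ^ N * (Csum * A * P) ≤ 2 ^ n * (Csum * A * P) := by gcongr
    _ = 2 ^ n * A * P * Csum := by ring

/-! ### The dyadic bump under a linear change of variables -/

/-- **The dyadic bump composed with a linear map**: for every `n` there is `Q` with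
`‖Dᴺ[φ₀ ∘ L](x)‖ ≤ Q max(1, ‖L‖)ⁿ` for all continuous linear `L : E → E`, `N ≤ n`, `x ∈ E` (chain
rule `Dᴺ(φ₀ ∘ L)(x) = Dᴺφ₀(Lx) ∘ (L, …, L)` and the Schwartz seminorms of `φ₀`). Rotated and
non-dyadically dilated bumps `φ_k(λR⁻¹ ·)` are thus admissible multipliers with universal
constants. -/
theorem exists_norm_iteratedFDeriv_dyadicSymbol_comp_le [MeasurableSpace E] [BorelSpace E] (n : ℕ) :
    ∃ Q : ℝ, 0 ≤ Q ∧ ∀ (L : E →L[ℝ] E) (N : ℕ), N ≤ n → ∀ x : E,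
      ‖iteratedFDeriv ℝ N (fun ξ : E => dyadicSymbol 0 (L ξ)) x‖ ≤ Q * (max 1 ‖L‖) ^ n := by
  set Q : ℝ := (Finset.Iic ((0 : ℕ), n)).sup (schwartzSeminormFamily ℂ E ℂ) (dyadicSymbolSchwartz E 0)
    with hQ
  have hQ0 : 0 ≤ Q := apply_nonneg _ _
  refine ⟨Q, hQ0, fun L N hN x => ?_⟩
  have hsm : ContDiff ℝ ∞ (dyadicSymbol (E := E) 0) := contDiff_dyadicSymbol 0
  have hcomp : (fun ξ : E => dyadicSymbol 0 (L ξ)) = dyadicSymbol (E := E) 0 ∘ ⇑L := rfl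
  rw [hcomp, L.iteratedFDeriv_comp_right hsm x (mod_cast le_top)]
  refine (ContinuousMultilinearMap.norm_compContinuousLinearMap_le _ _).trans ?_
  rw [Finset.prod_const, Finset.card_univ, Fintype.card_fin]
  have h1 : ‖iteratedFDeriv ℝ N (dyadicSymbol (E := E) 0) (L x)‖ ≤ Q := by
    rw [← coe_dyadicSymbolSchwartz (E := E)]
    have := le_seminorm ℂ 0 N (dyadicSymbolSchwartz E 0) (L x)
    rw [pow_zero, one_mul] at this
    refine this.trans (Seminorm.le_def.1 (Finset.le_sup (f := schwartzSeminormFamily ℂ E ℂ)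
      (Finset.mem_Iic.2 (Prod.mk_le_mk.2 ⟨le_rfl, hN⟩))) _)
  have h2 : ‖L‖ ^ N ≤ (max 1 ‖L‖) ^ n :=
    (pow_le_pow_left₀ (norm_nonneg _) (le_max_right _ _) N).trans
      (pow_le_pow_right₀ (le_max_left _ _) hN)
  exact mul_le_mul h1 h2 (by positivity) hQ0

/-! ### The `L¹` norm of the kernel of a multiplier cut off to the annulus -/

/-- **`‖𝓕⁻¹(G ψ)‖_{L¹} ≤ C₀ B`** (the `L¹`-kernel lemma behind the `L^∞` block estimates; BCD, proof
of Lemma 2.2): there are an order `n` and `C₀` such that for every multiplier `G` of temperate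
growth whose derivatives of order `≤ n` are bounded by `B ≥ 0` on the annulus `1/4 ≤ ‖ξ‖ ≤ 4`,
the kernel `𝓕⁻¹(G ψ)` (`ψ` the reproducing symbol of `Δ̇₀`) has `L¹` norm `≤ C₀ B`. -/
theorem exists_eLpNorm_fourierInv_smulLeftCLM_bernstein_le [MeasurableSpace E] [BorelSpace E] :
    ∃ (n : ℕ) (C₀ : ℝ≥0), ∀ (G : E → ℂ), G.HasTemperateGrowth → ∀ B : ℝ, 0 ≤ B →
      (∀ N ≤ n, ∀ x ∈ blockAnnulus E, ‖iteratedFDeriv ℝ N G x‖ ≤ B) →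
      eLpNorm (⇑(𝓕⁻ (SchwartzMap.smulLeftCLM ℂ G (bernsteinSchwartz E)) : 𝓢(E, ℂ))) 1 volume ≤
        C₀ * ENNReal.ofReal B := by
  -- adapted from `exists_eLpNormDistrib_fourierMultiplierCLM_lpBlock_zero_le` (LittlewoodPaleyMultiplierProofs)
  obtain ⟨s, C₀, h₀⟩ := exists_eLpNorm_fourierInv_le (E := E)
  set n : ℕ := s.sup Prod.snd with hn
  set A : ℝ := ∑ i ∈ s, 2 ^ i.2 * (Finset.Iic i).sup (schwartzSeminormFamily ℂ E ℂ) (bernsteinSchwartz E)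
    with hA
  have hA0 : 0 ≤ A := Finset.sum_nonneg fun i _ => by positivity
  refine ⟨n, C₀ * A.toNNReal, fun G hG B hB hGB => ?_⟩
  have hS : tsupport ((bernsteinSchwartz E : 𝓢(E, ℂ)) : E → ℂ) ⊆ blockAnnulus E := by
    rw [coe_bernsteinSchwartz]
    exact tsupport_bernsteinSymbol_subset
  set Ψ : 𝓢(E, ℂ) := SchwartzMap.smulLeftCLM ℂ G (bernsteinSchwartz E) with hΨ
  have hsemi : ∀ i ∈ s, schwartzSeminormFamily ℂ E ℂ i Ψ ≤
      2 ^ i.2 * (Finset.Iic i).sup (schwartzSeminormFamily ℂ E ℂ) (bernsteinSchwartz E) * B := by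
    intro i hi
    have hin : i.2 ≤ n := Finset.le_sup (f := Prod.snd) hi
    have h := seminorm_smulLeftCLM_le_of_bound_on hG hS (n := i.2) hB
      (fun N hN x hx => hGB N (hN.trans hin) x hx) i.1
    calc schwartzSeminormFamily ℂ E ℂ i Ψ = SchwartzMap.seminorm ℂ i.1 i.2 Ψ := rfl
      _ ≤ 2 ^ i.2 * B * (Finset.Iic (i.1, i.2)).sup (schwartzSeminormFamily ℂ E ℂ) (bernsteinSchwartz E) := h
      _ = 2 ^ i.2 * (Finset.Iic i).sup (schwartzSeminormFamily ℂ E ℂ) (bernsteinSchwartz E) * B := by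
          rw [Prod.mk.eta]; ring
  have hsup : s.sup (schwartzSeminormFamily ℂ E ℂ) Ψ ≤ A * B := by
    refine Seminorm.finset_sup_apply_le (by positivity) fun i hi => (hsemi i hi).trans ?_
    rw [hA, Finset.sum_mul]
    exact Finset.single_le_sum (f := fun i => 2 ^ i.2 *
      (Finset.Iic i).sup (schwartzSeminormFamily ℂ E ℂ) (bernsteinSchwartz E) * B)
      (fun j _ => by positivity) hi
  calc eLpNorm (⇑(𝓕⁻ Ψ : 𝓢(E, ℂ))) 1 volume
      ≤ C₀ * ENNReal.ofReal (s.sup (schwartzSeminormFamily ℂ E ℂ) Ψ) := h₀ Ψ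
    _ ≤ C₀ * ENNReal.ofReal (A * B) := by gcongr
    _ = ((C₀ * A.toNNReal : ℝ≥0) : ℝ≥0∞) * ENNReal.ofReal B := by
        rw [ENNReal.ofReal_mul hA0, ENNReal.coe_mul, mul_assoc]
        rfl

end General

/-! ### Tao's real order-`0` symbols -/

section Tao

open Literature.Analysis.FluidPDE.Tao2016

/-- **Tao's symbol seminorms bound the derivatives pointwise**: for a real order-`0` symbol `m`,
`‖Dᴺ m(ξ)‖ ≤ ‖m‖_N ‖ξ‖^{-N}` for `ξ ≠ 0` (Tao 2016, (1.10)). -/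
theorem norm_iteratedFDeriv_le_of_isRealSymbol {m : EuclideanSpace ℝ (Fin 3) → ℂ}
    (hm : IsRealSymbol m) (N : ℕ) (ξ : EuclideanSpace ℝ (Fin 3)) (hξ : ξ ≠ 0) :
    ‖iteratedFDeriv ℝ N m ξ‖ ≤ (symbolSeminorm N m).toReal * ‖ξ‖ ^ (-(N : ℝ)) := by
  have hfin : symbolSeminorm N m ≠ ⊤ := (hm.2.1 N).ne
  have hle : (‖ξ‖₊ : ℝ≥0∞) ^ N * ‖iteratedFDeriv ℝ N m ξ‖₊ ≤ symbolSeminorm N m :=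
    le_iSup₂ (f := fun (ξ : EuclideanSpace ℝ (Fin 3)) (_ : ξ ∈ ({0}ᶜ : Set (EuclideanSpace ℝ (Fin 3)))) =>
      (‖ξ‖₊ : ℝ≥0∞) ^ N * (‖iteratedFDeriv ℝ N m ξ‖₊ : ℝ≥0∞)) ξ hξ
  have hξpos : 0 < ‖ξ‖ := norm_pos_iff.2 hξ
  have hreal : ‖ξ‖ ^ N * ‖iteratedFDeriv ℝ N m ξ‖ ≤ (symbolSeminorm N m).toReal := by
    have h := ENNReal.toReal_mono hfin hle
    rwa [ENNReal.toReal_mul, ENNReal.toReal_pow, ← enorm_eq_nnnorm, ← enorm_eq_nnnorm,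
      toReal_enorm, toReal_enorm] at h
  rw [Real.rpow_neg (norm_nonneg _), Real.rpow_natCast, ← div_eq_mul_inv,
    le_div_iff₀ (pow_pos hξpos N), mul_comm]
  exact hreal

/-- A real order-`0` symbol is smooth off the origin (the `ContDiffOn ℝ ∞` form used by the
Littlewood–Paley library). -/
theorem contDiffOn_of_isRealSymbol {m : EuclideanSpace ℝ (Fin 3) → ℂ} (hm : IsRealSymbol m) :
    ContDiffOn ℝ ∞ m {0}ᶜ :=
  hm.1

variable {F : Type*} [NormedAddCommGroup F] [NormedSpace ℂ F] [CompleteSpace F]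

/-- **BCD Lemma 2.2 on the blocks, with constant `C ∑_{i ≤ n} ‖m‖_i`** (order-`0` case,
`L^∞` norms): there are an order `n` and a constant `C` such that for every real order-`0`
symbol `m` of Tao's class `𝓜₀`, every `j ∈ ℤ` and every `u ∈ 𝓢'(ℝ³, F)`,
`‖(m ψ_j)(D) Δ̇_j u‖_{L^∞} ≤ C (∑_{i ≤ n} ‖m‖_i) ‖Δ̇_j u‖_{L^∞}`, where `m ψ_j = truncSymbol m j` is
the block truncation (`= m(D) Δ̇_j` for temperate `m`). -/
theorem exists_eLpNormDistrib_truncSymbol_lpBlock_le_sum :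
    ∃ (n : ℕ) (C : ℝ≥0), ∀ (m : EuclideanSpace ℝ (Fin 3) → ℂ), IsRealSymbol m →
      ∀ (j : ℤ) (u : 𝓢'(EuclideanSpace ℝ (Fin 3), F)),
        eLpNormDistrib ∞ (fourierMultiplierCLM F (truncSymbol m j) (lpBlock j u)) ≤
          C * ENNReal.ofReal (∑ i ∈ Finset.range (n + 1), (symbolSeminorm i m).toReal) *
            eLpNormDistrib ∞ (lpBlock j u) := by
  obtain ⟨n, C, hC⟩ := exists_eLpNormDistrib_fourierMultiplierCLM_lpBlock_le
    (E := EuclideanSpace ℝ (Fin 3)) (F := F) ∞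
  obtain ⟨K₀, hK₀, hK⟩ := exists_norm_iteratedFDeriv_rescaled_mul_bernstein_le
    (E := EuclideanSpace ℝ (Fin 3)) n
  refine ⟨n, C * K₀.toNNReal, fun m hm j u => ?_⟩
  set S : ℝ := ∑ i ∈ Finset.range (n + 1), (symbolSeminorm i m).toReal with hS
  have hS0 : 0 ≤ S := Finset.sum_nonneg fun i _ => ENNReal.toReal_nonneg
  have habs : ∑ i ∈ Finset.range (n + 1), |(symbolSeminorm i m).toReal| = S :=
    Finset.sum_congr rfl fun i _ => abs_of_nonneg ENNReal.toReal_nonneg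
  have hderiv : ∀ N ≤ n, ∀ x ∈ blockAnnulus (EuclideanSpace ℝ (Fin 3)),
      ‖iteratedFDeriv ℝ N (fun ξ : EuclideanSpace ℝ (Fin 3) =>
        truncSymbol m j (((2 : ℝ) ^ j) • ξ)) x‖ ≤ K₀ * S := by
    intro N hN x hx
    have hfun : (fun ξ : EuclideanSpace ℝ (Fin 3) => truncSymbol m j (((2 : ℝ) ^ j) • ξ)) =
        fun ξ => m (((2 : ℝ) ^ j) • ξ) * bernsteinSymbol ξ :=
      funext fun ξ => truncSymbol_two_zpow_smul m j ξ
    rw [hfun, ← habs]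
    exact hK m (contDiffOn_of_isRealSymbol hm) (fun i => (symbolSeminorm i m).toReal)
      (fun N _ ξ hξ => norm_iteratedFDeriv_le_of_isRealSymbol hm N ξ hξ) _ (zpow_pos two_pos j)
      N hN x hx
  have hmain := hC (truncSymbol m j) (hasTemperateGrowth_truncSymbol (contDiffOn_of_isRealSymbol hm) j)
    j (K₀ * S) (by positivity) hderiv u
  calc eLpNormDistrib ∞ (fourierMultiplierCLM F (truncSymbol m j) (lpBlock j u))
      ≤ C * ENNReal.ofReal (K₀ * S) * eLpNormDistrib ∞ (lpBlock j u) := hmain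
    _ = ((C * K₀.toNNReal : ℝ≥0) : ℝ≥0∞) * ENNReal.ofReal S * eLpNormDistrib ∞ (lpBlock j u) := by
        rw [ENNReal.ofReal_mul hK₀, ENNReal.coe_mul]
        simp only [ENNReal.ofReal, mul_assoc]

end Tao

end Summit.NavierStokesRegularity.NavierStokesRegularity.Theorems.PerpetualPumpThesis.FA

namespace Summit.NavierStokesRegularity.NavierStokesRegularity.Theorems.PerpetualPumpThesis

open Literature.Analysis.FluidPDE Literature.Analysis.FluidPDE.Tao2016
open Literature.Analysis.FunctionSpaces

/-- **Part Symbols of stub `besovDuhamelBound` (registered sub-goal `stub_FA_Symbols`)**: BCD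
Lemma 2.2 on the dyadic blocks of `𝓢'(ℝ³, ℂ³)` for Tao's real order-`0` symbols, with the constant
displayed as `C ∑_{i ≤ n} ‖m‖_i`: `‖(m ψ_j)(D) Δ̇_j u‖_{L^∞} ≤ C (∑_{i≤n} ‖m‖_i) ‖Δ̇_j u‖_{L^∞}` for
all `m ∈ 𝓜₀`, `j ∈ ℤ`, `u` (the block bound through which the random multipliers of an averaged
Euler operator are averaged against Tao's moment bounds). -/
theorem stub_FA_Symbols : ∃ (n : ℕ) (C : NNReal), ∀ (m : EuclideanSpace ℝ (Fin 3) → ℂ), IsRealSymbol m → ∀ (j : ℤ) (u : 𝓢'(EuclideanSpace ℝ (Fin 3), EuclideanSpace ℂ (Fin 3))), eLpNormDistrib ⊤ (TemperedDistribution.fourierMultiplierCLM (EuclideanSpace ℂ (Fin 3)) (truncSymbol m j) (lpBlock j u)) ≤ (C : ENNReal) * ENNReal.ofReal (∑ i ∈ Finset.range (n + 1), (symbolSeminorm i m).toReal) * eLpNormDistrib ⊤ (lpBlock j u) :=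
  FA.exists_eLpNormDistrib_truncSymbol_lpBlock_le_sum

end Summit.NavierStokesRegularity.NavierStokesRegularity.Theorems.PerpetualPumpThesis
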